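import Literature.Topology.FourManifolds.FishtailTubeDZeroNorth
import HarnessLib

/-!
# The tube over the south cap of Gompf's disc, in the cap chart

Infrastructure for the explicit fishtail neighbourhood (R. Gompf, *More Cappell–Shaneson spheres
are standard*, Algebr. Geom. Topol. 10 (2010), proof of Thm 2.1 and Lemma 2.2; the named fact
`Literature.Topology.FourManifolds.gompf2010_framedTwist`). The centre `p` of Gompf's disc is the
south cap centre of the surgered section sphere. Over a point `d` of the south cap chart
(latitude `n₀ = -capN ε d > 0`, base `baseOf d`) the tube is the product chart of the new piece
(`capEnd`) for `‖d‖ < 1/2` and the rescaling zone `zoneS2` (sphere form, cone scale `κ(n₀) = c n₀`)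
beyond, glued along `‖d‖`: `Literature.Topology.FourManifolds.tubeD0S`. The two pieces agree on
the slab (`pieceS1_eq_pieceS2`) and the glued tube is a local diffeomorphism
(`isLocalDiffeomorphAt_tubeD0S`). Everything is proved; no named facts.

## References

* R. E. Gompf, *More Cappell–Shaneson spheres are standard*, Algebr. Geom. Topol. 10 (2010)
  1665–1681, proof of Thm 2.1 and Lemma 2.2. [GompfAGT2010]
-/

noncomputable section

open scoped Real ContDiff Topology Manifold
open Set Function Filter Complex Metric

namespace Literature.Topology.FourManifolds

local notation "𝔼 " n:arg => EuclideanSpace ℝ (Fin n)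

section South

variable {ε : ℝ} (hε : 0 < ε) (hε2 : ε ≤ 1 / 2) (cS : ℝ) (kapS : ℝ → ℝ)

/-- The south rescaling zone with the latitude sign of the chart: `(n, ϑ, w) ↦ zoneS2 (-n, ϑ, w)`. [folklore] -/
def zoneS2n (q : ℝ × ℝ × ℝ × ℝ) : MTorus tubeShearDiffeo := zoneS2 kapS (negN q)

/-- Piece 1: the product chart of the new piece at the south cap centre. [folklore] -/
def pieceS1 (q : ℂ × ℝ × ℝ) : (fishNu hε hε2).Surgered := capEnd (fishNu hε hε2) cS q

/-- Piece 2: the south rescaling zone read in the chart and in `X^σ`. [folklore] -/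
def pieceS2 (q : ℂ × ℝ × ℝ) : (fishNu hε hε2).Surgered := toSurg (fishNu hε hε2) (polarForm ε (zoneS2n kapS) q)

/-- **The tube over the south cap of `D⁰`**, glued along `‖d‖` at `1/2`. [folklore] -/
def tubeD0S : ℂ × ℝ × ℝ → (fishNu hε hε2).Surgered :=
  glueBy (fun q ↦ ‖q.1‖) (1 / 2) (pieceS1 hε hε2 cS) (pieceS2 hε hε2 kapS)

variable {cS kapS}

/-- The value of the signed zone. [folklore] -/
theorem zoneS2n_apply (q : ℝ × ℝ × ℝ × ℝ) :
    zoneS2n kapS q = mtCoord tubeShearDiffeo (scaleReal kapS (-q.1, baseOf (exp (q.2.1 * I)), q.2.2)) := rfl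

/-- Periodicity of the signed zone in the angle. [folklore] -/
theorem zoneS2n_add_two_pi (q : ℝ × ℝ × ℝ × ℝ) : zoneS2n kapS (q.1, q.2.1 + 2 * π, q.2.2) = zoneS2n kapS q :=
  twoChart_add_two_pi (G := fun p ↦ mtCoord tubeShearDiffeo (scaleReal kapS p)) (negN q)

/-- The rescaling depends on `κ` only through `κ(n₀)`. [folklore] -/
theorem scaleReal_congr {kap kap' : ℝ → ℝ} {q : ℝ × ℝ × ℝ × ℝ} (h : kap q.1 = kap' q.1) :
    scaleReal kap q = scaleReal kap' q := by
  simp [scaleReal, h]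

/-- **Pieces 1 and 2 agree** where `0 < ‖d‖ < 1`, `(c a)² + (c b)² < 1` and `κ(n₀) = c n₀`. [folklore] -/
theorem pieceS1_eq_pieceS2 {q : ℂ × ℝ × ℝ} (h0 : q.1 ≠ 0) (h1 : ‖q.1‖ < 1)
    (hadm : (cS * q.2.1) ^ 2 + (cS * q.2.2) ^ 2 < 1) (hcone : kapS (-capN ε q.1) = cS * (-capN ε q.1)) :
    pieceS1 hε hε2 cS q = pieceS2 hε hε2 kapS q := by
  rw [pieceS1, capEnd_eq_inl (ν := fishNu hε hε2) h1 h0]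
  have hn0 : 0 ≤ -capN ε q.1 := (neg_capN_pos hε h0).le
  have hV : (scaleReal kapS (-capN ε q.1, baseOf (exp (arg q.1 * I)), q.2)).1 =
      (-capN ε q.1) • thetaVec (cS * q.2.1, cS * q.2.2) := by
    rw [smul_thetaVec hn0]
    simp only [scaleReal, hcone, sphX]
    ext j; fin_cases j
    · simp only [Fin.zero_eta, Matrix.cons_val_zero]
      congr 1; ring
    · simp; ring
    · simp; ring
  have hX : polarForm ε (zoneS2n kapS) q =
      mtPt tubeShearDiffeo (expT ((-capN ε q.1) • thetaVec (cS * q.2.1, cS * q.2.2))) (baseOf q.1) := by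
    rw [polarForm_apply, zoneS2n_apply, mtCoord, hV]
    simp only
    rw [baseOf_exp_arg h0]
    rfl
  have hX' : polarForm ε (zoneS2n kapS) q =
      ((fishNu hε hε2).bwdA (toE2 q.1, thetaPt (cS * q.2.1, cS * q.2.2)) : MTorus tubeShearDiffeo) := by
    rw [hX, coe_capEnd_point tubeShearDiffeo hε (le_pi_of_le_half hε2) (tubeShearDiffeo_expT hε2) h0,
      coe_thetaPt (by simpa using hadm)]
  rw [pieceS2, toSurg_eq_inl (by rw [hX']; exact ((fishNu hε hε2).bwdA _).2)]
  congr 1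
  exact Subtype.ext hX'.symm

/-- **Piece 1 is a local diffeomorphism.** [folklore] -/
theorem isLocalDiffeomorphAt_pieceS1 (hc : cS ≠ 0) {q : ℂ × ℝ × ℝ} (h1 : ‖q.1‖ < 1)
    (hadm : (cS * q.2.1) ^ 2 + (cS * q.2.2) ^ 2 < 1) :
    IsLocalDiffeomorphAt 𝓘(ℝ, ℂ × ℝ × ℝ) 𝓘(ℝ, 𝔼 4) ∞ (pieceS1 hε hε2 cS) q :=
  isLocalDiffeomorphAt_capEnd (fishNu hε hε2) hc h1 hadm

/-- **Piece 2 is a local diffeomorphism** at `(d, a, b)`, `d ≠ 0`, `n₀ = -capN ε d < 1/2`, `κ` smooth,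
`κ(n₀) ≠ 0`, strictly admissible offsets. [folklore] -/
theorem isLocalDiffeomorphAt_pieceS2 (hkap : ContDiff ℝ ∞ kapS) {q : ℂ × ℝ × ℝ} (h0 : q.1 ≠ 0)
    (hn1 : -capN ε q.1 < 1 / 2) (hk : kapS (-capN ε q.1) ≠ 0)
    (hadm : (kapS (-capN ε q.1) * q.2.1) ^ 2 + (kapS (-capN ε q.1) * q.2.2) ^ 2 < (-capN ε q.1) ^ 2) :
    IsLocalDiffeomorphAt 𝓘(ℝ, ℂ × ℝ × ℝ) 𝓘(ℝ, 𝔼 4) ∞ (pieceS2 hε hε2 kapS) q := by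
  have hn : 0 < -capN ε q.1 := neg_capN_pos hε h0
  have hZ : IsLocalDiffeomorphAt 𝓘(ℝ, ℝ × ℝ × ℝ × ℝ) 𝓘(ℝ, 𝔼 4) ∞ (zoneS2n kapS) (capN ε q.1, arg q.1, q.2) := by
    have h1 : IsLocalDiffeomorphAt 𝓘(ℝ, ℝ × ℝ × ℝ × ℝ) 𝓘(ℝ, ℝ × ℝ × ℝ × ℝ) ∞ negN (capN ε q.1, arg q.1, q.2) :=
      negN.isLocalDiffeomorph _
    have h2 := isLocalDiffeomorphAt_zoneS2 hkap (q := (-capN ε q.1, arg q.1, q.2)) hn hn1 hk hadm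
    exact h1.comp (K := 𝓘(ℝ, 𝔼 4)) (P := MTorus tubeShearDiffeo) h2
  have hP : IsLocalDiffeomorphAt 𝓘(ℝ, ℂ × ℝ × ℝ) 𝓘(ℝ, 𝔼 4) ∞ (polarForm ε (zoneS2n kapS)) q :=
    isLocalDiffeomorphAt_polarForm' hε (fun n ϑ w ↦ zoneS2n_add_two_pi (n, ϑ, w)) h0 hZ
  have hmem : polarForm ε (zoneS2n kapS) q ∈ (fishNu hε hε2).complement := by
    rw [polarForm_apply, zoneS2n_apply, mtCoord]
    refine mtPt_mem_complement hε hε2 (expT_ne_one_of_fst ?_ ?_) (baseOf_mem' _).1 (baseOf_mem' _).2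
    · simp only [scaleReal, Matrix.cons_val_zero, sphX]
      refine (Real.sqrt_pos.2 ?_).ne'
      nlinarith [hadm]
    · simp only [scaleReal, Matrix.cons_val_zero, sphX]
      rw [abs_of_nonneg (Real.sqrt_nonneg _)]
      have : Real.sqrt ((-capN ε q.1) ^ 2 - (kapS (-capN ε q.1) * q.2.1) ^ 2 - (kapS (-capN ε q.1) * q.2.2) ^ 2)
          ≤ -capN ε q.1 := by
        rw [Real.sqrt_le_left hn.le]; nlinarith
      linarith [Real.pi_gt_three]
  exact hP.comp (K := 𝓘(ℝ, 𝔼 4)) (P := (fishNu hε hε2).Surgered) (isLocalDiffeomorphAt_toSurg (ν := fishNu hε hε2) hmem)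

/-- **The south `D⁰` tube is a local diffeomorphism** at `(d, a, b)`, `0 < ‖d‖ < 1`, under the cone
plateau (`κ(n₀) = c n₀` for `‖d‖ < 53/100`), `κ` smooth with `κ(n₀) ≠ 0`, `c ≠ 0`, and the
piecewise admissibility hypotheses. [folklore] -/
theorem isLocalDiffeomorphAt_tubeD0S (hkap : ContDiff ℝ ∞ kapS) (hc : cS ≠ 0)
    (hcone : ∀ d : ℂ, ‖d‖ < 53 / 100 → kapS (-capN ε d) = cS * (-capN ε d))
    {q : ℂ × ℝ × ℝ} (h1q : ‖q.1‖ < 1)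
    (h1 : ‖q.1‖ < 53 / 100 → (cS * q.2.1) ^ 2 + (cS * q.2.2) ^ 2 < 1)
    (h2 : 47 / 100 < ‖q.1‖ → kapS (-capN ε q.1) ≠ 0 ∧
      (kapS (-capN ε q.1) * q.2.1) ^ 2 + (kapS (-capN ε q.1) * q.2.2) ^ 2 < (-capN ε q.1) ^ 2) :
    IsLocalDiffeomorphAt 𝓘(ℝ, ℂ × ℝ × ℝ) 𝓘(ℝ, 𝔼 4) ∞ (tubeD0S hε hε2 cS kapS) q := by
  have hτ : Continuous fun q : ℂ × ℝ × ℝ ↦ ‖q.1‖ := continuous_norm.comp continuous_fst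
  have hn1 : -capN ε q.1 < 1 / 2 := by have := neg_capN_le hε q.1; nlinarith
  unfold tubeD0S
  rcases le_or_gt ‖q.1‖ (47 / 100) with hA | hA
  swap
  have h0 : q.1 ≠ 0 := fun h ↦ by rw [h, norm_zero] at hA; linarith
  swap
  · have hev : glueBy (fun q : ℂ × ℝ × ℝ ↦ ‖q.1‖) (1 / 2) (pieceS1 hε hε2 cS) (pieceS2 hε hε2 kapS)
        =ᶠ[𝓝 q] pieceS1 hε hε2 cS := by
      have ho : IsOpen {q' : ℂ × ℝ × ℝ | ‖q'.1‖ < 1 / 2} := isOpen_lt hτ continuous_const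
      exact eventuallyEq_of_mem (ho.mem_nhds (show ‖q.1‖ < 1 / 2 by linarith)) fun q' hq' ↦ glueBy_of_lt hq'
    exact isLocalDiffeomorphAt_congr_nhds' (isLocalDiffeomorphAt_pieceS1 hε hε2 hc h1q (h1 (by linarith))) hev
  rcases lt_or_ge ‖q.1‖ (53 / 100) with hB | hB
  · have hadm := h1 hB
    have ho : IsOpen {q' : ℂ × ℝ × ℝ | 47 / 100 < ‖q'.1‖ ∧ ‖q'.1‖ < 53 / 100 ∧ (cS * q'.2.1) ^ 2 + (cS * q'.2.2) ^ 2 < 1} := by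
      refine (isOpen_lt continuous_const hτ).and ((isOpen_lt hτ continuous_const).and ?_)
      exact isOpen_lt (((continuous_const.mul (continuous_fst.comp continuous_snd)).pow 2).add
        ((continuous_const.mul (continuous_snd.comp continuous_snd)).pow 2)) continuous_const
    have hev : glueBy (fun q : ℂ × ℝ × ℝ ↦ ‖q.1‖) (1 / 2) (pieceS1 hε hε2 cS) (pieceS2 hε hε2 kapS)
        =ᶠ[𝓝 q] pieceS2 hε hε2 kapS := by
      filter_upwards [ho.mem_nhds (show q ∈ {q' : ℂ × ℝ × ℝ | _} from ⟨hA, hB, hadm⟩)] with q' hq'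
      rcases lt_or_ge ‖q'.1‖ (1 / 2) with hl | hr
      · have h0' : q'.1 ≠ 0 := fun h ↦ by rw [h, norm_zero] at hq'; linarith [hq'.1]
        rw [glueBy_of_lt (τ := fun q : ℂ × ℝ × ℝ ↦ ‖q.1‖) hl,
          pieceS1_eq_pieceS2 hε hε2 h0' (by linarith) hq'.2.2 (hcone q'.1 hq'.2.1)]
      · rw [glueBy_of_le (τ := fun q : ℂ × ℝ × ℝ ↦ ‖q.1‖) hr]
    obtain ⟨hk, hadm2⟩ := h2 hA
    exact isLocalDiffeomorphAt_congr_nhds' (isLocalDiffeomorphAt_pieceS2 hε hε2 hkap h0 hn1 hk hadm2) hev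
  · have hev : glueBy (fun q : ℂ × ℝ × ℝ ↦ ‖q.1‖) (1 / 2) (pieceS1 hε hε2 cS) (pieceS2 hε hε2 kapS)
        =ᶠ[𝓝 q] pieceS2 hε hε2 kapS := by
      have ho : IsOpen {q' : ℂ × ℝ × ℝ | 1 / 2 < ‖q'.1‖} := isOpen_lt continuous_const hτ
      exact eventuallyEq_of_mem (ho.mem_nhds (show 1 / 2 < ‖q.1‖ by linarith)) fun q' hq' ↦ glueBy_of_le (le_of_lt hq')
    obtain ⟨hk, hadm2⟩ := h2 (by linarith)
    exact isLocalDiffeomorphAt_congr_nhds' (isLocalDiffeomorphAt_pieceS2 hε hε2 hkap h0 hn1 hk hadm2) hev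

end South

end Literature.Topology.FourManifolds
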